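import Literature.AlgebraicGeometry.Kawanoue2007.IdealisticFiltration
import Literature.AlgebraicGeometry.Resolution.DifferentialOperators
import Mathlib.Analysis.SpecificLimits.Basic
import Mathlib.Algebra.BigOperators.Intervals
import HarnessLib

/-!
# Kawanoue 2007, Part I, §2.1.2–§2.1.5 / Lemma 2.2.1.1: the 𝔇-, ℜ-, 𝔅-saturations and the integral closure of an idealistic filtration

H. Kawanoue, *Toward resolution of singularities over a field of positive characteristic. Part I.
Foundation; the language of the idealistic filtration*, Publ. RIMS **43** (2007) 819–909
(= arXiv:math/0607009) [Kawanoue2007]. Sequel of `IdealisticFiltration.lean` (Def. 2.1.1.1, `inter`,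
`generate`, `satBy`): this file types Definition 2.1.2.1 (𝔇-saturation), Definition 2.1.3.1
(ℜ-saturation) with Remark 2.1.3.2 (1)(2) PROVED, Definition 2.1.4.1 (integral closure), Definition
2.1.5.1 (𝔅-saturation), and Lemma 2.2.1.1 (1)(3) for each of them, as REAL Lean definitions with their
API proved; NO named facts are introduced. Locators = printed item numbers (journal = arXiv numbering);
pages re-read on the held arXiv text (`lit read paper:arxiv-math-0607009`, chunks p0051–p0055).
Campaign `res-hironaka` (D-0089), ladder rung LIT-6; first consumer = rescue catalogue row RR-133
(«𝔇-saturation / leading generator system» as OURS device).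

## What is typed, and how (faithfulness notes)

* **Def. 2.1.2.1.** `IsDSaturated k 𝕀`: «`(f, a) ∈ 𝕀, d ∈ Diff^t_R ⟹ (d(f), a − t) ∈ 𝕀`», where
  `Diff^t_R` = the differential operators of order `≤ t` of `R` over `k`. Kawanoue's `Diff^t_R` is
  defined through principal parts (Def. 1.1.1.1) and characterised by the Leibniz rule of degree `t`
  (Lemma 1.1.2.1 (1) = EGA IV₄ 16.8.8 (c)); we use the tree's `Resolution.IsDiffOpLE k t` (EGA IV₄
  16.8.8 (b), `Literature/AlgebraicGeometry/Resolution/DifferentialOperators.lean`) — the same class of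
  `k`-linear endomorphisms by EGA IV₄ Prop. 16.8.8. The condition is typed for an ARBITRARY graded family
  of operators `Δ : ℕ → Set (R →ₗ[k] R)` (`IsSaturatedFor Δ`), so that the logarithmic variant 𝔇_E
  («using the logarithmic differential operators with respect to `E` instead», condition
  (differential)_E) is `IsSaturatedFor (Diff_{R,E})` once logarithmic operators are available — they are
  NOT defined here. `DSat k 𝕀 = 𝔇(𝕀)` = the minimal 𝔇-saturated filtration containing `𝕀` (Lemma
  2.2.1.1 (3) via `satBy`), with `incl_DSat`, `isDSaturated_DSat`, `DSat_incl`, `DSat_eq_self`, `DSat_mono`.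
* **Def. 2.1.3.1, Rem. 2.1.3.2.** `IsRadical` (radical), `IsLevelContinuous` (continuity: real sequences
  `a_l → a`), `IsRSaturated` = both, `RSat = ℜ(𝕀)`; `IsFrobeniusClosed p` = condition (Frobenius) and
  **`isRadical_of_isFrobeniusClosed`** = Rem. 2.1.3.2 (1) ((Frobenius) + (continuity) ⟹ (radical)),
  proved by the printed argument (it uses only `p ≥ 2`, not that `p = char k`); `IsLeftContinuous` =
  (left continuity) and **`isLevelContinuous_iff_level_eq_iInf`** / **`isLeftContinuous_iff_level_eq_iInf`**
  = Rem. 2.1.3.2 (2): either continuity condition ⟺ `𝕀_a = ⋂_{b<a} 𝕀_b` for all `a`.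
* **Def. 2.1.4.1.** `IsIntegralElem 𝕀 f a` (monic equation `f^n + c_1 f^{n-1} + ⋯ + c_n = 0`,
  `(c_i, i a) ∈ 𝕀`), `IsIntegrallyClosedIF` (condition (ic); suffix to keep clear of Mathlib's
  `IsIntegrallyClosed`), `integralClosure = IC(𝕀)`.
* **Def. 2.1.5.1.** `IsBSaturated k` = 𝔇- and ℜ-saturated, `BSat k = 𝔅(𝕀)`.
* **Lemma 2.2.1.1 (1)(3).** `isSaturatedFor_inter`, `isDSaturated_inter`, `isRSaturated_inter`,
  `isIntegrallyClosedIF_inter`, `isBSaturated_inter` (stability under intersections), and the `_spec`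
  lemmas (containment, saturatedness, minimality) of `RSat`, `integralClosure`, `BSat`.

Deliberately NOT here: the explicit generators of the saturations (Lemma 2.2.1.2, Cor. 2.4.2.3), the
coincidence `ℜ = IC` for r.f.g. type (Cor. 2.3.2.7), «(continuity) is automatic for r.f.g. type»
(Cor. 2.3.2.3), localization/completion (§2.4), Chapter 3. Nothing of Hironaka's 2017 manuscript is
referred to or asserted.

## References

* H. Kawanoue, Publ. RIMS 43 (2007) 819–909 = arXiv:math/0607009: Def. 2.1.2.1, Def. 2.1.3.1, Rem.
  2.1.3.2, Def. 2.1.4.1, Def. 2.1.5.1, Lemma 2.2.1.1. [Kawanoue2007]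
* A. Grothendieck, J. Dieudonné, ÉGA IV₄, Déf. 16.8.1 / Prop. 16.8.8 (the tree's `Resolution.IsDiffOpLE`).
  [EGAIV4]
-/

namespace Literature.AlgebraicGeometry.Kawanoue2007

open Literature.AlgebraicGeometry.Resolution (IsDiffOpLE)
open Filter

namespace IdealisticFiltration

variable {R : Type*} [CommRing R]

/-! ## Def. 2.1.2.1: 𝔇-saturation -/

section DSat

variable (k : Type*) [CommRing k] [Algebra k R]

/-- Saturation for a graded family of operators `Δ = (Δ_t)_{t ∈ ℕ}`, `Δ_t ⊂ End_k(R)`: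
`(f, a) ∈ 𝕀, d ∈ Δ_t ⇒ (d f, a − t) ∈ 𝕀`. With `Δ_t = Diff^t_R` this is condition (differential) of
Def. 2.1.2.1 (`IsDSaturated`); with `Δ_t = Diff^t_{R,E}` (logarithmic operators w.r.t. a simple normal
crossing divisor `E` — not defined in this file) it is condition (differential)_E.
[cite: Kawanoue2007, Def. 2.1.2.1] -/
def IsSaturatedFor (Δ : ℕ → Set (R →ₗ[k] R)) (𝕀 : IdealisticFiltration R) : Prop :=
  ∀ (t : ℕ) (d : R →ₗ[k] R), d ∈ Δ t → ∀ (a : ℝ) (f : R), f ∈ 𝕀.level a → d f ∈ 𝕀.level (a - t)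

/-- **𝔇-saturated** [Def. 2.1.2.1, condition (differential)]: «`(f, a) ∈ 𝕀, d ∈ Diff^t_R ⟹
(d(f), a − t) ∈ 𝕀`», `Diff^t_R` = differential operators of order `≤ t` of `R` over `k`
(`Resolution.IsDiffOpLE k t`, EGA IV₄ 16.8.8 = Kawanoue Def. 1.1.1.1 / Lemma 1.1.2.1 (1)).
[cite: Kawanoue2007, Def. 2.1.2.1] -/
def IsDSaturated (𝕀 : IdealisticFiltration R) : Prop :=
  IsSaturatedFor k (fun t => {d | IsDiffOpLE k t d}) 𝕀

/-- Unfolding of `IsDSaturated`. [cite: Kawanoue2007, Def. 2.1.2.1] -/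
theorem isDSaturated_iff (𝕀 : IdealisticFiltration R) :
    IsDSaturated k 𝕀 ↔ ∀ (t : ℕ) (d : R →ₗ[k] R), IsDiffOpLE k t d →
      ∀ (a : ℝ) (f : R), f ∈ 𝕀.level a → d f ∈ 𝕀.level (a - t) :=
  Iff.rfl

/-- Saturation for `Δ` is stable under intersections. [cite: Kawanoue2007, Lemma 2.2.1.1 (1)] -/
theorem isSaturatedFor_inter (Δ : ℕ → Set (R →ₗ[k] R)) (S : Set (IdealisticFiltration R))
    (hS : ∀ 𝕁 ∈ S, IsSaturatedFor k Δ 𝕁) : IsSaturatedFor k Δ (inter S) :=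
  fun t d hd a f hf => mem_level_inter_iff.mpr fun 𝕁 h𝕁 =>
    hS 𝕁 h𝕁 t d hd a f (mem_level_inter_iff.mp hf 𝕁 h𝕁)

/-- 𝔇-saturated filtrations are stable under intersections. [cite: Kawanoue2007, Lemma 2.2.1.1 (1)] -/
theorem isDSaturated_inter (S : Set (IdealisticFiltration R)) (hS : ∀ 𝕁 ∈ S, IsDSaturated k 𝕁) :
    IsDSaturated k (inter S) :=
  isSaturatedFor_inter k _ S hS

/-- **`𝔇(𝕀)`, the 𝔇-saturation**: «the minimal 𝔇-saturated idealistic filtration containing `𝕀`».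
[cite: Kawanoue2007, Def. 2.1.2.1 and Lemma 2.2.1.1 (3)] -/
def DSat (𝕀 : IdealisticFiltration R) : IdealisticFiltration R := satBy (IsDSaturated k) 𝕀

/-- `𝕀 ⊂ 𝔇(𝕀)`. [cite: Kawanoue2007, Def. 2.1.2.1] -/
theorem incl_DSat (𝕀 : IdealisticFiltration R) : Incl 𝕀 (DSat k 𝕀) := incl_satBy _ 𝕀

/-- `𝔇(𝕀)` is 𝔇-saturated. [cite: Kawanoue2007, Def. 2.1.2.1 and Lemma 2.2.1.1 (3)] -/
theorem isDSaturated_DSat (𝕀 : IdealisticFiltration R) : IsDSaturated k (DSat k 𝕀) :=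
  satBy_prop (isDSaturated_inter k) 𝕀

/-- Minimality of `𝔇(𝕀)`. [cite: Kawanoue2007, Def. 2.1.2.1] -/
theorem DSat_incl {𝕀 𝕁 : IdealisticFiltration R} (h : Incl 𝕀 𝕁) (h𝕁 : IsDSaturated k 𝕁) :
    Incl (DSat k 𝕀) 𝕁 :=
  satBy_incl h h𝕁

/-- `𝔇(𝕀) = 𝕀` for a 𝔇-saturated `𝕀`; in particular `𝔇(𝔇(𝕀)) = 𝔇(𝕀)`. [cite: Kawanoue2007, Def. 2.1.2.1] -/
theorem DSat_eq_self {𝕀 : IdealisticFiltration R} (h : IsDSaturated k 𝕀) : DSat k 𝕀 = 𝕀 := satBy_eq_self h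

/-- `𝔇` is monotone. [cite: Kawanoue2007, Def. 2.1.2.1] -/
theorem DSat_mono {𝕀 𝕁 : IdealisticFiltration R} (h : Incl 𝕀 𝕁) : Incl (DSat k 𝕀) (DSat k 𝕁) :=
  satBy_mono (isDSaturated_inter k) h

end DSat

/-! ## Def. 2.1.3.1: ℜ-saturation; Def. 2.1.4.1: integral closure; Def. 2.1.5.1: 𝔅-saturation -/

/-- Condition (radical): «`(f^n, n a) ∈ 𝕀, f ∈ R, n ∈ ℤ_{>0} ⟹ (f, a) ∈ 𝕀`». [cite: Kawanoue2007, Def. 2.1.3.1] -/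
def IsRadical (𝕀 : IdealisticFiltration R) : Prop :=
  ∀ (f : R) (a : ℝ) (n : ℕ), 0 < n → f ^ n ∈ 𝕀.level (n * a) → f ∈ 𝕀.level a

/-- Condition (continuity): «`{(f, a_l)} ⊂ 𝕀` with `lim_{l → ∞} a_l = a ⟹ (f, a) ∈ 𝕀`».
[cite: Kawanoue2007, Def. 2.1.3.1] -/
def IsLevelContinuous (𝕀 : IdealisticFiltration R) : Prop :=
  ∀ (f : R) (u : ℕ → ℝ) (a : ℝ), (∀ l, f ∈ 𝕀.level (u l)) →
    Filter.Tendsto u Filter.atTop (nhds a) → f ∈ 𝕀.level a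

/-- **ℜ-saturated** = (radical) and (continuity). [cite: Kawanoue2007, Def. 2.1.3.1] -/
def IsRSaturated (𝕀 : IdealisticFiltration R) : Prop := 𝕀.IsRadical ∧ 𝕀.IsLevelContinuous

/-- Condition (Frobenius) in characteristic `p`: «`(f^p, p a) ∈ 𝕀, f ∈ R ⟹ (f, a) ∈ 𝕀`» (a priori
weaker than (radical); together with (continuity) it implies (radical), Rem. 2.1.3.2 (1) = `isRadical_of_isFrobeniusClosed`).
[cite: Kawanoue2007, Rem. 2.1.3.2 (1)] -/
def IsFrobeniusClosed (p : ℕ) (𝕀 : IdealisticFiltration R) : Prop :=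
  ∀ (f : R) (a : ℝ), f ^ p ∈ 𝕀.level (p * a) → f ∈ 𝕀.level a

/-- Iterating condition (Frobenius) `e` times: `(f^{p^e}, p^e b) ∈ 𝕀 ⟹ (f, b) ∈ 𝕀`.
[cite: Kawanoue2007, Rem. 2.1.3.2 (1) (proof)] -/
theorem IsFrobeniusClosed.of_pow_pow_mem {p : ℕ} {𝕀 : IdealisticFiltration R}
    (hF : 𝕀.IsFrobeniusClosed p) :
    ∀ (e : ℕ) (f : R) (b : ℝ), f ^ p ^ e ∈ 𝕀.level ((p : ℝ) ^ e * b) → f ∈ 𝕀.level b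
  | 0, f, b, h => by simpa using h
  | e + 1, f, b, h => by
    refine IsFrobeniusClosed.of_pow_pow_mem hF e f b (hF (f ^ p ^ e) ((p : ℝ) ^ e * b) ?_)
    have h1 : (f ^ p ^ e) ^ p = f ^ p ^ (e + 1) := by rw [← pow_mul, ← pow_succ]
    have h2 : ((p : ℝ) * ((p : ℝ) ^ e * b)) = (p : ℝ) ^ (e + 1) * b := by ring
    rw [h1, h2]; exact h

/-- **Remark 2.1.3.2 (1)**: «if an idealistic filtration `𝕀` satisfies condition (Frobenius), which is a
priori slightly weaker than condition (radical), and condition (continuity), then it actually satisfies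
conditions (radical) and (continuity)». The printed proof: for `(f^n, n a) ∈ 𝕀` take `p^e > n`,
`0 ≤ r < n` with `r ≡ p^e (mod n)`; then `(f^{p^e − r}, a (p^e − r)) ∈ 𝕀` by (ii), `(f^{p^e}, a (p^e − r))
∈ 𝕀` by (i), `(f, a (1 − p^{−e} r)) ∈ 𝕀` by (Frobenius), and `(f, a) ∈ 𝕀` by (continuity) with
`e → ∞`. Only `p ≥ 2` is used (in print `p = char k > 0`). [cite: Kawanoue2007, Rem. 2.1.3.2 (1)] -/
theorem isRadical_of_isFrobeniusClosed {p : ℕ} (hp : 1 < p) {𝕀 : IdealisticFiltration R}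
    (hF : 𝕀.IsFrobeniusClosed p) (hc : 𝕀.IsLevelContinuous) : 𝕀.IsRadical := by
  intro f a n hn hfn
  have hp0 : (p : ℝ) ≠ 0 := by exact_mod_cast (show p ≠ 0 by omega)
  -- the levels `a (p^e - r_e) / p^e`, `r_e = p^e mod n`, written as `(n ⌊p^e / n⌋) a / p^e`
  let u : ℕ → ℝ := fun e => ((n * (p ^ e / n) : ℕ) : ℝ) * a / (p : ℝ) ^ e
  have hmem : ∀ e, f ∈ 𝕀.level (u e) := by
    intro e
    refine hF.of_pow_pow_mem e f (u e) ?_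
    -- (ii): `(f^n)^{⌊p^e/n⌋} ∈ 𝕀` at level `⌊p^e/n⌋ (n a)`
    have hm : f ^ (n * (p ^ e / n)) ∈ 𝕀.level (((p ^ e / n : ℕ) : ℝ) * (n * a)) := by
      rw [pow_mul]; exact 𝕀.pow_mem hfn _
    -- (i): multiply by `f^{r_e}`
    have hsplit : f ^ p ^ e = f ^ (p ^ e % n) * f ^ (n * (p ^ e / n)) := by
      rw [← pow_add, add_comm, Nat.div_add_mod]
    have hlev : (p : ℝ) ^ e * u e = ((p ^ e / n : ℕ) : ℝ) * (n * a) := by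
      have hpe : (p : ℝ) ^ e ≠ 0 := pow_ne_zero _ hp0
      simp only [u]
      field_simp
      push_cast
      ring
    rw [hsplit, hlev]
    exact 𝕀.mul_mem_left _ hm
  refine hc f u a hmem ?_
  -- `u e = a − a · r_e / p^e → a` since `0 ≤ r_e < n`
  have hr : Tendsto (fun e : ℕ => ((p ^ e % n : ℕ) : ℝ) / (p : ℝ) ^ e) atTop (nhds 0) := by
    have hgeom : Tendsto (fun e : ℕ => (n : ℝ) * (1 / (p : ℝ)) ^ e) atTop (nhds 0) := by
      have h1 : (0 : ℝ) ≤ 1 / (p : ℝ) := by positivity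
      have h2 : 1 / (p : ℝ) < 1 := by
        rw [div_lt_one (by exact_mod_cast (show 0 < p by omega))]
        exact_mod_cast hp
      simpa using (tendsto_pow_atTop_nhds_zero_of_lt_one h1 h2).const_mul (n : ℝ)
    refine tendsto_of_tendsto_of_tendsto_of_le_of_le tendsto_const_nhds hgeom
      (fun e => by positivity) fun e => ?_
    have hlt : ((p ^ e % n : ℕ) : ℝ) ≤ n := by exact_mod_cast (Nat.mod_lt _ hn).le
    have hpe : (0 : ℝ) < (p : ℝ) ^ e := by positivity
    rw [one_div_pow, mul_one_div]
    exact div_le_div_of_nonneg_right hlt hpe.le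
  have hu : u = fun e : ℕ => a - a * (((p ^ e % n : ℕ) : ℝ) / (p : ℝ) ^ e) := by
    funext e
    have hpe : (p : ℝ) ^ e ≠ 0 := pow_ne_zero _ hp0
    have hdm : ((n * (p ^ e / n) : ℕ) : ℝ) = (p : ℝ) ^ e - ((p ^ e % n : ℕ) : ℝ) := by
      rw [eq_sub_iff_add_eq]; exact_mod_cast Nat.div_add_mod (p ^ e) n
    simp only [u, hdm]
    field_simp
  rw [hu]
  simpa using tendsto_const_nhds.sub (tendsto_const_nhds.mul hr)

/-- Condition (left continuity): «`{(f, a_l)} ⊂ 𝕀` with `{a_l}` increasing and `lim a_l = a ⟹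
(f, a) ∈ 𝕀`». [cite: Kawanoue2007, Rem. 2.1.3.2 (2)] -/
def IsLeftContinuous (𝕀 : IdealisticFiltration R) : Prop :=
  ∀ (f : R) (u : ℕ → ℝ) (a : ℝ), Monotone u → (∀ l, f ∈ 𝕀.level (u l)) →
    Filter.Tendsto u Filter.atTop (nhds a) → f ∈ 𝕀.level a

/-- (left continuity) ⟹ `𝕀_a = ⋂_{b<a} 𝕀_b` (use `a_l = a − 1/(l+1)`).
[cite: Kawanoue2007, Rem. 2.1.3.2 (2)] -/
theorem level_eq_iInf_of_isLeftContinuous {𝕀 : IdealisticFiltration R} (h : 𝕀.IsLeftContinuous)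
    (a : ℝ) : 𝕀.level a = ⨅ b ∈ Set.Iio a, 𝕀.level b := by
  refine le_antisymm (le_iInf₂ fun b hb => 𝕀.antitone (le_of_lt hb)) fun f hf => ?_
  have hf' : ∀ b < a, f ∈ 𝕀.level b := by
    intro b hb
    exact (Submodule.mem_iInf _).mp ((Submodule.mem_iInf _).mp hf b) hb
  refine h f (fun l => a - 1 / ((l : ℝ) + 1)) a (fun i j hij => ?_) (fun l => hf' _ ?_) ?_
  · dsimp only; gcongr
  · have : (0 : ℝ) < 1 / ((l : ℝ) + 1) := by positivity
    linarith
  · have h0 : Tendsto (fun l : ℕ => 1 / ((l : ℝ) + 1)) atTop (nhds 0) :=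
      tendsto_one_div_add_atTop_nhds_zero_nat
    simpa using tendsto_const_nhds.sub h0

/-- `𝕀_a = ⋂_{b<a} 𝕀_b` for all `a` ⟹ (continuity) (for `b < a`, eventually `a_l > b`, so
`f ∈ 𝕀_{a_l} ⊂ 𝕀_b` by (iii)). [cite: Kawanoue2007, Rem. 2.1.3.2 (2)] -/
theorem isLevelContinuous_of_level_eq_iInf {𝕀 : IdealisticFiltration R}
    (h : ∀ a : ℝ, 𝕀.level a = ⨅ b ∈ Set.Iio a, 𝕀.level b) : 𝕀.IsLevelContinuous := by
  intro f u a hu hlim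
  rw [h a]
  refine (Submodule.mem_iInf _).mpr fun b => (Submodule.mem_iInf _).mpr fun hb => ?_
  obtain ⟨l, hl⟩ := (hlim.eventually (lt_mem_nhds (Set.mem_Iio.mp hb))).exists
  exact 𝕀.antitone (le_of_lt hl) (hu l)

/-- **Remark 2.1.3.2 (2)**: (continuity) ⟺ «`𝕀_a = ⋂_{b<a} 𝕀_b ∀ a ∈ ℝ`».
[cite: Kawanoue2007, Rem. 2.1.3.2 (2)] -/
theorem isLevelContinuous_iff_level_eq_iInf (𝕀 : IdealisticFiltration R) :
    𝕀.IsLevelContinuous ↔ ∀ a : ℝ, 𝕀.level a = ⨅ b ∈ Set.Iio a, 𝕀.level b :=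
  ⟨fun h => level_eq_iInf_of_isLeftContinuous fun f u a _ hu hlim => h f u a hu hlim,
    isLevelContinuous_of_level_eq_iInf⟩

/-- **Remark 2.1.3.2 (2)**: (left continuity) ⟺ «`𝕀_a = ⋂_{b<a} 𝕀_b ∀ a ∈ ℝ`».
[cite: Kawanoue2007, Rem. 2.1.3.2 (2)] -/
theorem isLeftContinuous_iff_level_eq_iInf (𝕀 : IdealisticFiltration R) :
    𝕀.IsLeftContinuous ↔ ∀ a : ℝ, 𝕀.level a = ⨅ b ∈ Set.Iio a, 𝕀.level b :=
  ⟨level_eq_iInf_of_isLeftContinuous,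
    fun h f u a _ hu hlim => isLevelContinuous_of_level_eq_iInf h f u a hu hlim⟩

/-- **Remark 2.1.3.2 (2)**: «in view of condition (iii), requiring condition (continuity) is equivalent
to requiring (left continuity)». [cite: Kawanoue2007, Rem. 2.1.3.2 (2)] -/
theorem isLevelContinuous_iff_isLeftContinuous (𝕀 : IdealisticFiltration R) :
    𝕀.IsLevelContinuous ↔ 𝕀.IsLeftContinuous := by
  rw [isLevelContinuous_iff_level_eq_iInf, isLeftContinuous_iff_level_eq_iInf]

/-- ℜ-saturated filtrations are stable under intersections. [cite: Kawanoue2007, Lemma 2.2.1.1 (1)] -/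
theorem isRSaturated_inter (S : Set (IdealisticFiltration R)) (hS : ∀ 𝕁 ∈ S, IsRSaturated 𝕁) :
    IsRSaturated (inter S) :=
  ⟨fun f a n hn hf => mem_level_inter_iff.mpr fun 𝕁 h𝕁 =>
      (hS 𝕁 h𝕁).1 f a n hn (mem_level_inter_iff.mp hf 𝕁 h𝕁),
    fun f u a hu hlim => mem_level_inter_iff.mpr fun 𝕁 h𝕁 =>
      (hS 𝕁 h𝕁).2 f u a (fun l => mem_level_inter_iff.mp (hu l) 𝕁 h𝕁) hlim⟩

/-- **`ℜ(𝕀)`, the ℜ-saturation**: «the minimal ℜ-saturated idealistic filtration containing `𝕀`».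
[cite: Kawanoue2007, Def. 2.1.3.1 and Lemma 2.2.1.1 (3)] -/
def RSat (𝕀 : IdealisticFiltration R) : IdealisticFiltration R := satBy IsRSaturated 𝕀

/-- `𝕀 ⊂ ℜ(𝕀)`, `ℜ(𝕀)` is ℜ-saturated, and it is minimal. [cite: Kawanoue2007, Def. 2.1.3.1] -/
theorem RSat_spec (𝕀 : IdealisticFiltration R) :
    Incl 𝕀 (RSat 𝕀) ∧ IsRSaturated (RSat 𝕀) ∧
      ∀ 𝕁 : IdealisticFiltration R, Incl 𝕀 𝕁 → IsRSaturated 𝕁 → Incl (RSat 𝕀) 𝕁 :=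
  ⟨incl_satBy _ 𝕀, satBy_prop isRSaturated_inter 𝕀, fun _ h h𝕁 => satBy_incl h h𝕁⟩

/-- «`(f, a) ∈ R × ℝ` is integral over `𝕀` if `f` satisfies a monic equation
`f^n + c_1 f^{n−1} + ⋯ + c_n = 0` with `(c_i, i a) ∈ 𝕀` for `i = 1, …, n`» (`n ≥ 1`).
[cite: Kawanoue2007, Def. 2.1.4.1 (1)] -/
def IsIntegralElem (𝕀 : IdealisticFiltration R) (f : R) (a : ℝ) : Prop :=
  ∃ n : ℕ, 0 < n ∧ ∃ c : ℕ → R, (∀ i ∈ Finset.Icc 1 n, c i ∈ 𝕀.level (i * a)) ∧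
    f ^ n + ∑ i ∈ Finset.Icc 1 n, c i * f ^ (n - i) = 0

/-- Condition (ic): «`(f, a)` integral over `𝕀 ⟹ (f, a) ∈ 𝕀`» — `𝕀` is integrally closed (named
`…IF` to keep clear of Mathlib's `IsIntegrallyClosed`). [cite: Kawanoue2007, Def. 2.1.4.1 (2)] -/
def IsIntegrallyClosedIF (𝕀 : IdealisticFiltration R) : Prop :=
  ∀ (f : R) (a : ℝ), 𝕀.IsIntegralElem f a → f ∈ 𝕀.level a

/-- If `(f, a)` is integral over `⋂ S` then (by the same equation) it is integral over each member of
`S`; hence integrally closed filtrations are stable under intersections.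
[cite: Kawanoue2007, Lemma 2.2.1.1 (1)] -/
theorem isIntegrallyClosedIF_inter (S : Set (IdealisticFiltration R))
    (hS : ∀ 𝕁 ∈ S, IsIntegrallyClosedIF 𝕁) : IsIntegrallyClosedIF (inter S) := by
  intro f a ⟨n, hn, c, hc, heq⟩
  exact mem_level_inter_iff.mpr fun 𝕁 h𝕁 =>
    hS 𝕁 h𝕁 f a ⟨n, hn, c, fun i hi => mem_level_inter_iff.mp (hc i hi) 𝕁 h𝕁, heq⟩

/-- **`IC(𝕀)`, the integral closure**: «the minimal integrally closed idealistic filtration containing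
`𝕀`». [cite: Kawanoue2007, Def. 2.1.4.1 and Lemma 2.2.1.1 (3)] -/
def integralClosure (𝕀 : IdealisticFiltration R) : IdealisticFiltration R := satBy IsIntegrallyClosedIF 𝕀

/-- `𝕀 ⊂ IC(𝕀)`, `IC(𝕀)` is integrally closed, and it is minimal. [cite: Kawanoue2007, Def. 2.1.4.1] -/
theorem integralClosure_spec (𝕀 : IdealisticFiltration R) :
    Incl 𝕀 𝕀.integralClosure ∧ IsIntegrallyClosedIF 𝕀.integralClosure ∧
      ∀ 𝕁 : IdealisticFiltration R, Incl 𝕀 𝕁 → IsIntegrallyClosedIF 𝕁 → Incl 𝕀.integralClosure 𝕁 :=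
  ⟨incl_satBy _ 𝕀, satBy_prop isIntegrallyClosedIF_inter 𝕀, fun _ h h𝕁 => satBy_incl h h𝕁⟩

section BSat

variable (k : Type*) [CommRing k] [Algebra k R]

/-- **𝔅-saturated** = «both 𝔇-saturated and ℜ-saturated». [cite: Kawanoue2007, Def. 2.1.5.1] -/
def IsBSaturated (𝕀 : IdealisticFiltration R) : Prop := IsDSaturated k 𝕀 ∧ IsRSaturated 𝕀

/-- 𝔅-saturated filtrations are stable under intersections. [cite: Kawanoue2007, Lemma 2.2.1.1 (1)] -/
theorem isBSaturated_inter (S : Set (IdealisticFiltration R)) (hS : ∀ 𝕁 ∈ S, IsBSaturated k 𝕁) :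
    IsBSaturated k (inter S) :=
  ⟨isDSaturated_inter k S fun 𝕁 h => (hS 𝕁 h).1, isRSaturated_inter S fun 𝕁 h => (hS 𝕁 h).2⟩

/-- **`𝔅(𝕀)`, the 𝔅-saturation**: «the minimal 𝔅-saturated idealistic filtration containing `𝕀`».
[cite: Kawanoue2007, Def. 2.1.5.1 and Lemma 2.2.1.1 (3)] -/
def BSat (𝕀 : IdealisticFiltration R) : IdealisticFiltration R := satBy (IsBSaturated k) 𝕀

/-- `𝕀 ⊂ 𝔅(𝕀)`, `𝔅(𝕀)` is 𝔅-saturated, and it is minimal. [cite: Kawanoue2007, Def. 2.1.5.1] -/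
theorem BSat_spec (𝕀 : IdealisticFiltration R) :
    Incl 𝕀 (BSat k 𝕀) ∧ IsBSaturated k (BSat k 𝕀) ∧
      ∀ 𝕁 : IdealisticFiltration R, Incl 𝕀 𝕁 → IsBSaturated k 𝕁 → Incl (BSat k 𝕀) 𝕁 :=
  ⟨incl_satBy _ 𝕀, satBy_prop (isBSaturated_inter k) 𝕀, fun _ h h𝕁 => satBy_incl h h𝕁⟩

/-- `𝔇(𝕀) ⊂ 𝔅(𝕀)` and `ℜ(𝕀) ⊂ 𝔅(𝕀)`. [cite: Kawanoue2007, Def. 2.1.5.1] -/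
theorem DSat_incl_BSat_and_RSat_incl_BSat (𝕀 : IdealisticFiltration R) :
    Incl (DSat k 𝕀) (BSat k 𝕀) ∧ Incl (RSat 𝕀) (BSat k 𝕀) :=
  ⟨DSat_incl k (BSat_spec k 𝕀).1 (BSat_spec k 𝕀).2.1.1,
    (RSat_spec 𝕀).2.2 _ (BSat_spec k 𝕀).1 (BSat_spec k 𝕀).2.1.2⟩

end BSat

end IdealisticFiltration

end Literature.AlgebraicGeometry.Kawanoue2007
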